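import Literature.MathematicalPhysics.QuantumFieldTheory.Balaban1983to89.Beta.OneStepResolventKernel

/-!
# `BalabanUV.Beta.GAN24.TaylorBlockSum` — binder row G-an2-4 / (CONV-C), S-slot, road «S3-Taylor» (`SKELETON-S3.md` v0.6 §12.7):
# generic leaf **W4 `blockSum_exp_le`** — RESCALED BLOCK SUMS OF A VERTEX WITH BLOCK-DECAYING LEGS ARE `O(1)`, UNIFORMLY IN THE BLOCKING,
# WITH HALF THE RATE ON THE SPREAD OF THE LEG ENDPOINTS

NOT IN PRINT; OUR BOOKKEEPING (engine «TAYLOR-W4*» of the idle G-an2-4 swarm leaf seat b2b-balaban-gan24-formalise-leaf-04, gen 17;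
records-grade until the row owner gan24-p1 says «file it» / the typer tables W4).  HONEST FRAMING (cell contract, verbatim): «discharging
`BetaPertH` makes Bałaban's UV stability UNCONDITIONAL — a real constructive-QFT result; it is NOT the continuum limit and NOT the Clay
problem.»  HONEST DEPENDENCY (verbatim): «continuum YM on T⁴ ⇐ BetaPertH ∧ nine spine estimates (0/9 proved); BetaPertH ⇐ (D1) ∧ (D4) ∧
CAP+tail; G-an2-4 gates asym, D1 and NE2/3/4.»  [folklore] analysis on `ℤ^D`: cites nothing, mints no `def … : Prop`, defines nothing,
uses no object of an1/an2/an3, instantiates no wall binder.  Discharges NOTHING of «E3Shape»/«E3SupRate», (hS, hSall), the W-slot, (D1);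
NOT BetaPertH, NOT continuum, NOT Clay.

## Why (context only; asserted nowhere below)

In the (PC-1) unit split of the normalised third jet (`GAN24/E3UnitSplit.e3W_unit_split`, member `n+1`, `N = Lc^(n+1)`) the location `u`
of the cubic vertex is summed as the BLOCK AVERAGE `N^{−(d+1)} Σ'_{u ∈ ℤ^{d+1}}`, and every leg meeting the vertex (`H̃_N = N^{d+2}·wH_N`
to the source `u′`, `G̃_N`/`H̃_N` to the read-out points `x′`, `z′`) is, by (N1) `FineReadoutDecay.exists_wH_decay`, bounded by a constant
times `e^{−κ |quo_N (fine point) − (coarse point)|}` — exponential decay on the BLOCK scale.  After the one first-order Taylor step of row W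
(W1/W3) cashes the explicit `N`, what is left is the lattice sum of this file:
`Σ'_u N^{−D} e^{−κ(|quo_N u − x′|₁ + |quo_N u − u′|₁ + |quo_N u − z′|₁)} ≤ Zl_D(κ/2) · e^{−(κ/2)(|x′ − u′|₁ + |z′ − u′|₁)}` (§3), i.e. the
`BiLoc … u′ u′ _ (κ/2)` shape of `LocStencil` in the read-out variables, `N`-FREE constant (two legs, `blockSum_exp_le₂`: rows V/Λ).  Sup-norm
legs (the format of (N1)) convert to the `ℓ¹` currency by `VolumePeriodise.l1_le_mul_supNorm`/`T4GaugeActionRatePair.exp_sup_le_exp_l1` upstream.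

## Contents (all [folklore]; `D` = dimension, `N ≥ 1` the blocking, `quo N u = ⌊u/N⌋` coordinatewise = `LatticeForm.quo`)
§1 BLOCK BOOKKEEPING: `card_box`; a block-constant lift `u ↦ g (quo N u)` of a summable coarse `g` is summable (`summable_comp_quo`) with
   `Σ'_u g (quo N u) = N^D · Σ'_y g y` (`tsum_comp_quo`) — so the BLOCK AVERAGE of a block-constant function is the coarse sum
   (`tsum_blockAvg_comp_quo`); `quo` is `ℓ¹`-Lipschitz up to `D`: `|quo N w − quo N u|₁ ≤ |w − u|₁/N + D` (`l1_quo_sub_quo_le`, from the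
   one-coordinate `abs_ediv_sub_ediv_le`), hence a block-decaying leg may be moved between fine points at finite distance at the price of the
   constant `e^{κ(|w−u|₁/N + D)}` (`exp_quo_transfer`).
§2 COARSE VERTEX SUMS: `Σ'_q e^{−κ(|q−x|₁+|q−z|₁)} ≤ Zl_D(κ/2)·e^{−(κ/2)|x−z|₁}` (`tsum_two_leg_le`) and
   `Σ'_q e^{−κ(|q−x|₁+|q−r|₁+|q−z|₁)} ≤ Zl_D(κ/2)·e^{−(κ/2)(|x−r|₁+|z−r|₁)}` (`tsum_three_leg_le`), with the pointwise splittings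
   (`two_leg_le`, `three_leg_le`, `exp_two_leg_le`, `exp_three_leg_le`) and summability; for a root and an ARBITRARY non-empty finite family of
   `m` legs the uniform splitting gives rate `κ/(2m)` on the spread (`legs_le`, `exp_legs_le`, `summable_legs`, `tsum_legs_le`).
§3 **W4**: the rescaled fine block sums `Σ'_u (N^D)⁻¹ e^{−κ(legs at quo N u)}` obey the SAME bounds, `N`-uniformly (`blockSum_exp_le₂`,
   **`blockSum_exp_le`**, `blockSum_legs_le`), are summable (`summable_blockSum_exp₂`, `summable_blockSum_exp`, `summable_blockSum_legs`), and
   the DOMINATED forms: a fine family `F` with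
   `|F u| ≤ C·e^{−κ(legs at quo N u)}` has an absolutely convergent block average bounded by `C·Zl_D(κ/2)·e^{−(κ/2)(spread)}`
   (`summable_blockAvg_of_le₂/₃`, `abs_tsum_blockAvg_le₂/₃`).
Inputs BY NAME: `ExpKernelCalculus` (`Zl`, `summable_exp_shift'`, `tsum_exp_shift'`, `l1_sub_triangle`, `l1_sub_symm`),
`KKTFluctuationEnergy` (`blockEquiv`, `tsum_blocks`, `quo_zsmul_add_toSite`), `BlochFibreUniqueness` (`quo_add_zsmul`, `quo_repZ`).
-/

noncomputable section
open Finset Filter Topology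
open scoped BigOperators
open Literature.MathematicalPhysics.QuantumFieldTheory Literature.MathematicalPhysics.QuantumFieldTheory.Balaban1983to89
open Literature.MathematicalPhysics.QuantumFieldTheory.Balaban1983to89.Beta
open Literature.Probability.LatticeModels (TorusSite)
open B12Sec2to5 (l1 l1_nonneg)
open ExpKernelCalculus (Zl summable_exp_shift' tsum_exp_shift' l1_sub_triangle l1_sub_symm)
open LatticeForm (quo repZ)
open BlochFibreUniqueness (quo_add_zsmul quo_repZ)
open AffineAveraging (toSite)
open KKTFluctuationEnergy (blockEquiv tsum_blocks quo_zsmul_add_toSite)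

namespace Summit.QuantumFields.BalabanUV.Beta.GAN24.TaylorBlockSum
variable {D N : ℕ}

/-! ## §1 Block bookkeeping -/

/-- [folklore] `#box = N^D`. -/
theorem card_box (D N : ℕ) : (AffineAveraging.box D N).card = N ^ D := by
  simp [AffineAveraging.box, Fintype.card_piFinset, Finset.card_range, Finset.prod_const, Finset.card_univ,
    Fintype.card_fin]

/-- [folklore] The block-constant lift `u ↦ g (quo N u)` of a summable coarse function is summable on the fine lattice. -/
theorem summable_comp_quo [NeZero N] {g : (Fin D → ℤ) → ℝ} (hg : Summable g) :
    Summable (fun u : Fin D → ℤ => g (quo N u)) := by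
  have h1 : Summable (fun p : (Fin D → ℤ) × TorusSite D N => g p.1 * (fun _ => (1 : ℝ)) p.2) := by
    refine summable_mul_of_summable_norm (R := ℝ) (f := g) (g := fun _ : TorusSite D N => (1 : ℝ)) ?_ ?_
    · simpa only [Real.norm_eq_abs] using hg.abs
    · exact Summable.of_finite
  have h2 : Summable ((fun u : Fin D → ℤ => g (quo N u)) ∘ ⇑(blockEquiv D N)) := by
    refine h1.congr (fun p => ?_)
    obtain ⟨y, z⟩ := p
    show g y * 1 = g (quo N (repZ z + (N : ℤ) • y))
    rw [quo_add_zsmul, quo_repZ, zero_add, mul_one]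
  exact (blockEquiv D N).summable_iff.mp h2

/-- [folklore] **BLOCK SUM OF A BLOCK-CONSTANT FUNCTION**: `Σ'_u g (quo N u) = N^D · Σ'_y g y` (each block has `N^D` points). -/
theorem tsum_comp_quo [NeZero N] {g : (Fin D → ℤ) → ℝ} (hg : Summable g) :
    ∑' u : Fin D → ℤ, g (quo N u) = (N : ℝ) ^ D * ∑' y : Fin D → ℤ, g y := by
  rw [tsum_blocks (N := N) (summable_comp_quo (N := N) hg)]
  have h : ∀ y : Fin D → ℤ, ∑ b ∈ AffineAveraging.box D N, g (quo N ((N : ℤ) • y + toSite b)) = (N : ℝ) ^ D * g y := by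
    intro y
    rw [Finset.sum_congr rfl (fun b hb => by rw [quo_zsmul_add_toSite (N := N) y hb]), Finset.sum_const, card_box,
      nsmul_eq_mul]
    push_cast
    ring
  rw [tsum_congr h, tsum_mul_left]

/-- [folklore] **THE BLOCK AVERAGE OF A BLOCK-CONSTANT FUNCTION IS THE COARSE SUM**: `Σ'_u (N^D)⁻¹ · g (quo N u) = Σ'_y g y`. -/
theorem tsum_blockAvg_comp_quo [NeZero N] {g : (Fin D → ℤ) → ℝ} (hg : Summable g) :
    ∑' u : Fin D → ℤ, ((N : ℝ) ^ D)⁻¹ * g (quo N u) = ∑' y : Fin D → ℤ, g y := by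
  have hN : ((N : ℝ) ^ D) ≠ 0 := pow_ne_zero _ (Nat.cast_ne_zero.mpr (NeZero.ne N))
  rw [tsum_mul_left, tsum_comp_quo (N := N) hg, ← mul_assoc, inv_mul_cancel₀ hN, one_mul]

/-- [folklore] … and the block-average family is summable. -/
theorem summable_blockAvg_comp_quo [NeZero N] {g : (Fin D → ℤ) → ℝ} (hg : Summable g) :
    Summable (fun u : Fin D → ℤ => ((N : ℝ) ^ D)⁻¹ * g (quo N u)) :=
  (summable_comp_quo (N := N) hg).mul_left _

/-- [folklore] One coordinate: Euclidean quotients by `N ≥ 1` are `1/N`-Lipschitz up to `1`: `|a/N − b/N| ≤ |a − b|/N + 1` (as reals). -/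
theorem abs_ediv_sub_ediv_le {N : ℕ} (hN : 0 < N) (a b : ℤ) :
    (((|a / (N : ℤ) - b / (N : ℤ)| : ℤ) : ℝ)) ≤ |((a - b : ℤ) : ℝ)| / N + 1 := by
  have hN' : (0 : ℤ) < N := by exact_mod_cast hN
  have hNr : (0 : ℝ) < N := by exact_mod_cast hN
  -- `N (qa − qb) = (a − b) − (ra − rb)` with `0 ≤ ra, rb < N`
  have key : (N : ℝ) * (((a / (N : ℤ) - b / (N : ℤ) : ℤ) : ℝ))
      = ((a - b : ℤ) : ℝ) - (((a % (N : ℤ) : ℤ) : ℝ) - ((b % (N : ℤ) : ℤ) : ℝ)) := by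
    have h1 : ((a % (N : ℤ) : ℤ) : ℝ) + (N : ℝ) * ((a / (N : ℤ) : ℤ) : ℝ) = (a : ℝ) := by
      exact_mod_cast Int.emod_add_mul_ediv a N
    have h2 : ((b % (N : ℤ) : ℤ) : ℝ) + (N : ℝ) * ((b / (N : ℤ) : ℤ) : ℝ) = (b : ℝ) := by
      exact_mod_cast Int.emod_add_mul_ediv b N
    push_cast
    linear_combination h1 - h2
  have hra0' : (0 : ℝ) ≤ ((a % (N : ℤ) : ℤ) : ℝ) := by exact_mod_cast Int.emod_nonneg a hN'.ne'
  have hrb0' : (0 : ℝ) ≤ ((b % (N : ℤ) : ℤ) : ℝ) := by exact_mod_cast Int.emod_nonneg b hN'.ne'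
  have hraN' : ((a % (N : ℤ) : ℤ) : ℝ) < N := by exact_mod_cast Int.emod_lt_of_pos a hN'
  have hrbN' : ((b % (N : ℤ) : ℤ) : ℝ) < N := by exact_mod_cast Int.emod_lt_of_pos b hN'
  set q : ℝ := (((a / (N : ℤ) - b / (N : ℤ) : ℤ)) : ℝ) with hq
  set s : ℝ := ((a - b : ℤ) : ℝ) with hs
  have hqabs : (N : ℝ) * |q| ≤ |s| + N := by
    rw [← abs_of_pos hNr, ← abs_mul, abs_of_pos hNr, key]
    refine (abs_sub _ _).trans ?_
    have : |((a % (N : ℤ) : ℤ) : ℝ) - ((b % (N : ℤ) : ℤ) : ℝ)| ≤ N := by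
      rw [abs_le]; constructor <;> linarith
    linarith
  rw [Int.cast_abs]
  rw [div_add_one hNr.ne', le_div_iff₀ hNr]
  linarith

/-- [folklore] **`quo` IS `ℓ¹`-LIPSCHITZ UP TO `D`**: `|quo N w − quo N u|₁ ≤ |w − u|₁ / N + D`. -/
theorem l1_quo_sub_quo_le [NeZero N] (w u : Fin D → ℤ) :
    l1 (quo N w - quo N u) ≤ l1 (w - u) / N + D := by
  have hN : 0 < N := Nat.pos_of_ne_zero (NeZero.ne N)
  have hcoord : ∀ j : Fin D, |(((quo N w - quo N u) j : ℤ) : ℝ)| ≤ |(((w - u) j : ℤ) : ℝ)| / N + 1 := by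
    intro j
    have h := abs_ediv_sub_ediv_le hN (w j) (u j)
    rw [Int.cast_abs] at h
    simpa only [quo, Pi.sub_apply] using h
  calc l1 (quo N w - quo N u) = ∑ j, |(((quo N w - quo N u) j : ℤ) : ℝ)| := rfl
    _ ≤ ∑ j, (|(((w - u) j : ℤ) : ℝ)| / N + 1) := Finset.sum_le_sum fun j _ => hcoord j
    _ = l1 (w - u) / N + D := by
        rw [Finset.sum_add_distrib, Finset.sum_const, Finset.card_univ, Fintype.card_fin, ← Finset.sum_div]
        simp [l1]

/-- [folklore] **LEG TRANSFER** between fine points: a leg decaying in the block index of `w` is at most `e^{κ(|w − u|₁/N + D)}` times the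
same leg at `u` — `e^{−κ|quo N w − p|₁} ≤ e^{κ(|w−u|₁/N + D)} · e^{−κ|quo N u − p|₁}` (finite-range tables move legs for an `N`-free price). -/
theorem exp_quo_transfer [NeZero N] {κ : ℝ} (hκ : 0 ≤ κ) (w u p : Fin D → ℤ) :
    Real.exp (-κ * l1 (quo N w - p)) ≤ Real.exp (κ * (l1 (w - u) / N + D)) * Real.exp (-κ * l1 (quo N u - p)) := by
  rw [← Real.exp_add]
  refine Real.exp_le_exp.mpr ?_
  have h1 : l1 (quo N u - p) ≤ l1 (quo N u - quo N w) + l1 (quo N w - p) := l1_sub_triangle _ _ _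
  have h2 : l1 (quo N u - quo N w) ≤ l1 (w - u) / N + D := by
    rw [l1_sub_symm]; exact l1_quo_sub_quo_le (N := N) w u
  nlinarith [l1_nonneg (quo N w - p)]

/-! ## §2 Coarse vertex sums with two and three exponentially decaying legs -/

/-- [folklore] Two legs, pointwise: `|x − z|₁/2 + |q − x|₁/2 ≤ |q − x|₁ + |q − z|₁`. -/
theorem two_leg_le (q x z : Fin D → ℤ) : l1 (x - z) / 2 + l1 (q - x) / 2 ≤ l1 (q - x) + l1 (q - z) := by
  have h1 : l1 (x - z) ≤ l1 (x - q) + l1 (q - z) := l1_sub_triangle x q z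
  rw [l1_sub_symm x q] at h1
  linarith [l1_nonneg (q - z)]

/-- [folklore] Three legs, pointwise: `(|x − r|₁ + |z − r|₁)/2 + |q − x|₁/2 ≤ |q − x|₁ + |q − r|₁ + |q − z|₁`. -/
theorem three_leg_le (q x r z : Fin D → ℤ) :
    (l1 (x - r) + l1 (z - r)) / 2 + l1 (q - x) / 2 ≤ l1 (q - x) + l1 (q - r) + l1 (q - z) := by
  have h1 : l1 (x - r) ≤ l1 (x - q) + l1 (q - r) := l1_sub_triangle x q r
  have h2 : l1 (z - r) ≤ l1 (z - q) + l1 (q - r) := l1_sub_triangle z q r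
  rw [l1_sub_symm x q] at h1
  rw [l1_sub_symm z q] at h2
  linarith [l1_nonneg (q - z)]

/-- [folklore] Two legs, exponential form (`κ ≥ 0`): `e^{−κ(|q−x|₁+|q−z|₁)} ≤ e^{−(κ/2)|x−z|₁} · e^{−(κ/2)|q−x|₁}`. -/
theorem exp_two_leg_le {κ : ℝ} (hκ : 0 ≤ κ) (q x z : Fin D → ℤ) :
    Real.exp (-κ * (l1 (q - x) + l1 (q - z))) ≤ Real.exp (-(κ / 2) * l1 (x - z)) * Real.exp (-(κ / 2) * l1 (q - x)) := by
  rw [← Real.exp_add]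
  refine Real.exp_le_exp.mpr ?_
  have h := mul_le_mul_of_nonneg_left (two_leg_le q x z) hκ
  linarith

/-- [folklore] Three legs, exponential form (`κ ≥ 0`):
`e^{−κ(|q−x|₁+|q−r|₁+|q−z|₁)} ≤ e^{−(κ/2)(|x−r|₁+|z−r|₁)} · e^{−(κ/2)|q−x|₁}`. -/
theorem exp_three_leg_le {κ : ℝ} (hκ : 0 ≤ κ) (q x r z : Fin D → ℤ) :
    Real.exp (-κ * (l1 (q - x) + l1 (q - r) + l1 (q - z)))
      ≤ Real.exp (-(κ / 2) * (l1 (x - r) + l1 (z - r))) * Real.exp (-(κ / 2) * l1 (q - x)) := by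
  rw [← Real.exp_add]
  refine Real.exp_le_exp.mpr ?_
  have h := mul_le_mul_of_nonneg_left (three_leg_le q x r z) hκ
  linarith

/-- [folklore] The two-leg family is summable over the vertex. -/
theorem summable_two_leg {κ : ℝ} (hκ : 0 < κ) (x z : Fin D → ℤ) :
    Summable (fun q : Fin D → ℤ => Real.exp (-κ * (l1 (q - x) + l1 (q - z)))) :=
  Summable.of_nonneg_of_le (fun _ => (Real.exp_pos _).le) (fun q => exp_two_leg_le hκ.le q x z)
    ((summable_exp_shift' (half_pos hκ) x).mul_left _)

/-- [folklore] The three-leg family is summable over the vertex. -/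
theorem summable_three_leg {κ : ℝ} (hκ : 0 < κ) (x r z : Fin D → ℤ) :
    Summable (fun q : Fin D → ℤ => Real.exp (-κ * (l1 (q - x) + l1 (q - r) + l1 (q - z)))) :=
  Summable.of_nonneg_of_le (fun _ => (Real.exp_pos _).le) (fun q => exp_three_leg_le hκ.le q x r z)
    ((summable_exp_shift' (half_pos hκ) x).mul_left _)

/-- [folklore] **TWO-LEG VERTEX SUM**: `Σ'_q e^{−κ(|q−x|₁+|q−z|₁)} ≤ Zl_D(κ/2) · e^{−(κ/2)|x−z|₁}`. -/
theorem tsum_two_leg_le {κ : ℝ} (hκ : 0 < κ) (x z : Fin D → ℤ) :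
    ∑' q : Fin D → ℤ, Real.exp (-κ * (l1 (q - x) + l1 (q - z))) ≤ Zl D (κ / 2) * Real.exp (-(κ / 2) * l1 (x - z)) := by
  have hmaj := (summable_exp_shift' (D := D) (half_pos hκ) x).mul_left (Real.exp (-(κ / 2) * l1 (x - z)))
  calc ∑' q : Fin D → ℤ, Real.exp (-κ * (l1 (q - x) + l1 (q - z)))
      ≤ ∑' q : Fin D → ℤ, Real.exp (-(κ / 2) * l1 (x - z)) * Real.exp (-(κ / 2) * l1 (q - x)) :=
        Summable.tsum_le_tsum (fun q => exp_two_leg_le hκ.le q x z) (summable_two_leg hκ x z) hmaj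
    _ = Zl D (κ / 2) * Real.exp (-(κ / 2) * l1 (x - z)) := by rw [tsum_mul_left, tsum_exp_shift', mul_comm]

/-- [folklore] **THREE-LEG VERTEX SUM**: `Σ'_q e^{−κ(|q−x|₁+|q−r|₁+|q−z|₁)} ≤ Zl_D(κ/2) · e^{−(κ/2)(|x−r|₁+|z−r|₁)}` — half the rate survives on
the spread of the endpoints about the root `r`, uniformly in everything else. -/
theorem tsum_three_leg_le {κ : ℝ} (hκ : 0 < κ) (x r z : Fin D → ℤ) :
    ∑' q : Fin D → ℤ, Real.exp (-κ * (l1 (q - x) + l1 (q - r) + l1 (q - z)))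
      ≤ Zl D (κ / 2) * Real.exp (-(κ / 2) * (l1 (x - r) + l1 (z - r))) := by
  have hmaj := (summable_exp_shift' (D := D) (half_pos hκ) x).mul_left (Real.exp (-(κ / 2) * (l1 (x - r) + l1 (z - r))))
  calc ∑' q : Fin D → ℤ, Real.exp (-κ * (l1 (q - x) + l1 (q - r) + l1 (q - z)))
      ≤ ∑' q : Fin D → ℤ, Real.exp (-(κ / 2) * (l1 (x - r) + l1 (z - r))) * Real.exp (-(κ / 2) * l1 (q - x)) :=
        Summable.tsum_le_tsum (fun q => exp_three_leg_le hκ.le q x r z) (summable_three_leg hκ x r z) hmaj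
    _ = Zl D (κ / 2) * Real.exp (-(κ / 2) * (l1 (x - r) + l1 (z - r))) := by rw [tsum_mul_left, tsum_exp_shift', mul_comm]

/-- [folklore] A ROOT AND AN ARBITRARY NON-EMPTY FINITE FAMILY OF LEGS, pointwise (uniform, non-sharp splitting):
`(Σ_{i∈s} |p i − r|₁)/(2·#s) + |q − r|₁/2 ≤ Σ_{i∈s} |q − p i|₁ + |q − r|₁`. -/
theorem legs_le {ι : Type*} (s : Finset ι) (hs : s.Nonempty) (p : ι → Fin D → ℤ) (q r : Fin D → ℤ) :
    (∑ i ∈ s, l1 (p i - r)) / (2 * s.card) + l1 (q - r) / 2 ≤ (∑ i ∈ s, l1 (q - p i)) + l1 (q - r) := by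
  have hm : (1 : ℝ) ≤ s.card := by exact_mod_cast hs.card_pos
  have h1 : ∑ i ∈ s, l1 (p i - r) ≤ (∑ i ∈ s, l1 (q - p i)) + s.card * l1 (q - r) := by
    calc ∑ i ∈ s, l1 (p i - r) ≤ ∑ i ∈ s, (l1 (q - p i) + l1 (q - r)) := Finset.sum_le_sum fun i _ => by
            have h := l1_sub_triangle (p i) q r
            rw [l1_sub_symm (p i) q] at h
            exact h
      _ = (∑ i ∈ s, l1 (q - p i)) + s.card * l1 (q - r) := by
          rw [Finset.sum_add_distrib, Finset.sum_const, nsmul_eq_mul]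
  have h2 : 0 ≤ ∑ i ∈ s, l1 (q - p i) := Finset.sum_nonneg fun i _ => l1_nonneg _
  have h4 : (∑ i ∈ s, l1 (p i - r)) / (2 * s.card) ≤ (∑ i ∈ s, l1 (q - p i)) / 2 + l1 (q - r) / 2 := by
    rw [div_le_iff₀ (by positivity)]
    nlinarith [mul_nonneg h2 (sub_nonneg.mpr hm)]
  linarith [l1_nonneg (q - r)]

/-- [folklore] Root + finite family of legs, exponential form (`κ ≥ 0`): the rate `κ/(2·#s)` survives on the spread `Σ_i |p i − r|₁` and `κ/2`
on the root leg (for exactly two endpoint legs `exp_three_leg_le` is sharper: rate `κ/2` on the spread). -/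
theorem exp_legs_le {ι : Type*} {κ : ℝ} (hκ : 0 ≤ κ) (s : Finset ι) (hs : s.Nonempty) (p : ι → Fin D → ℤ)
    (q r : Fin D → ℤ) :
    Real.exp (-κ * ((∑ i ∈ s, l1 (q - p i)) + l1 (q - r)))
      ≤ Real.exp (-(κ / (2 * s.card)) * ∑ i ∈ s, l1 (p i - r)) * Real.exp (-(κ / 2) * l1 (q - r)) := by
  rw [← Real.exp_add]
  refine Real.exp_le_exp.mpr ?_
  have h := mul_le_mul_of_nonneg_left (legs_le s hs p q r) hκ
  have hc : (0 : ℝ) < 2 * s.card := by have := hs.card_pos; positivity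
  have e : -(κ / (2 * s.card)) * (∑ i ∈ s, l1 (p i - r)) + -(κ / 2) * l1 (q - r)
      = -(κ * ((∑ i ∈ s, l1 (p i - r)) / (2 * s.card) + l1 (q - r) / 2)) := by
    field_simp
    ring
  rw [e]
  linarith

/-- [folklore] The root-plus-family leg function is summable over the vertex. -/
theorem summable_legs {ι : Type*} {κ : ℝ} (hκ : 0 < κ) (s : Finset ι) (hs : s.Nonempty) (p : ι → Fin D → ℤ)
    (r : Fin D → ℤ) :
    Summable (fun q : Fin D → ℤ => Real.exp (-κ * ((∑ i ∈ s, l1 (q - p i)) + l1 (q - r)))) :=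
  Summable.of_nonneg_of_le (fun _ => (Real.exp_pos _).le) (fun q => exp_legs_le hκ.le s hs p q r)
    ((summable_exp_shift' (half_pos hκ) r).mul_left _)

/-- [folklore] **VERTEX SUM, ROOT + `m ≥ 1` LEGS**: `Σ'_q e^{−κ(Σ_{i∈s}|q − p i|₁ + |q − r|₁)} ≤ Zl_D(κ/2) · e^{−(κ/(2·#s)) Σ_{i∈s}|p i − r|₁}`. -/
theorem tsum_legs_le {ι : Type*} {κ : ℝ} (hκ : 0 < κ) (s : Finset ι) (hs : s.Nonempty) (p : ι → Fin D → ℤ)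
    (r : Fin D → ℤ) :
    ∑' q : Fin D → ℤ, Real.exp (-κ * ((∑ i ∈ s, l1 (q - p i)) + l1 (q - r)))
      ≤ Zl D (κ / 2) * Real.exp (-(κ / (2 * s.card)) * ∑ i ∈ s, l1 (p i - r)) := by
  have hmaj := (summable_exp_shift' (D := D) (half_pos hκ) r).mul_left
    (Real.exp (-(κ / (2 * s.card)) * ∑ i ∈ s, l1 (p i - r)))
  calc ∑' q : Fin D → ℤ, Real.exp (-κ * ((∑ i ∈ s, l1 (q - p i)) + l1 (q - r)))
      ≤ ∑' q : Fin D → ℤ, Real.exp (-(κ / (2 * s.card)) * ∑ i ∈ s, l1 (p i - r)) * Real.exp (-(κ / 2) * l1 (q - r)) :=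
        Summable.tsum_le_tsum (fun q => exp_legs_le hκ.le s hs p q r) (summable_legs hκ s hs p r) hmaj
    _ = Zl D (κ / 2) * Real.exp (-(κ / (2 * s.card)) * ∑ i ∈ s, l1 (p i - r)) := by
        rw [tsum_mul_left, tsum_exp_shift', mul_comm]

/-! ## §3 W4: rescaled block sums of a vertex with block-decaying legs -/

/-- [folklore] The two-leg block-average family is summable on the fine lattice. -/
theorem summable_blockSum_exp₂ [NeZero N] {κ : ℝ} (hκ : 0 < κ) (x z : Fin D → ℤ) :
    Summable (fun u : Fin D → ℤ => ((N : ℝ) ^ D)⁻¹ * Real.exp (-κ * (l1 (quo N u - x) + l1 (quo N u - z)))) :=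
  summable_blockAvg_comp_quo (N := N) (summable_two_leg hκ x z)

/-- [folklore] The three-leg block-average family is summable on the fine lattice. -/
theorem summable_blockSum_exp [NeZero N] {κ : ℝ} (hκ : 0 < κ) (x r z : Fin D → ℤ) :
    Summable (fun u : Fin D → ℤ => ((N : ℝ) ^ D)⁻¹ * Real.exp (-κ * (l1 (quo N u - x) + l1 (quo N u - r) + l1 (quo N u - z)))) :=
  summable_blockAvg_comp_quo (N := N) (summable_three_leg hκ x r z)

/-- [folklore] **W4, TWO LEGS**: `Σ'_u (N^D)⁻¹ e^{−κ(|quo N u − x|₁ + |quo N u − z|₁)} ≤ Zl_D(κ/2) · e^{−(κ/2)|x − z|₁}`, `N`-uniformly. -/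
theorem blockSum_exp_le₂ [NeZero N] {κ : ℝ} (hκ : 0 < κ) (x z : Fin D → ℤ) :
    ∑' u : Fin D → ℤ, ((N : ℝ) ^ D)⁻¹ * Real.exp (-κ * (l1 (quo N u - x) + l1 (quo N u - z)))
      ≤ Zl D (κ / 2) * Real.exp (-(κ / 2) * l1 (x - z)) :=
  (tsum_blockAvg_comp_quo (N := N) (summable_two_leg hκ x z)).trans_le (tsum_two_leg_le hκ x z)

/-- [folklore] **W4 `blockSum_exp_le` (`SKELETON-S3.md` v0.6 §12.7)**: the rescaled block sum of a vertex with THREE block-decaying legs —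
to the read-out points `x`, `z` and to the root `r` — is `O(1)` uniformly in the blocking `N`, with half the rate on the spread:
`Σ'_u (N^D)⁻¹ e^{−κ(|quo N u − x|₁ + |quo N u − r|₁ + |quo N u − z|₁)} ≤ Zl_D(κ/2) · e^{−(κ/2)(|x − r|₁ + |z − r|₁)}` — the `BiLoc … r r _ (κ/2)`
shape of `LocStencil` in the variables `(x, z)`. -/
theorem blockSum_exp_le [NeZero N] {κ : ℝ} (hκ : 0 < κ) (x r z : Fin D → ℤ) :
    ∑' u : Fin D → ℤ, ((N : ℝ) ^ D)⁻¹ * Real.exp (-κ * (l1 (quo N u - x) + l1 (quo N u - r) + l1 (quo N u - z)))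
      ≤ Zl D (κ / 2) * Real.exp (-(κ / 2) * (l1 (x - r) + l1 (z - r))) :=
  (tsum_blockAvg_comp_quo (N := N) (summable_three_leg hκ x r z)).trans_le (tsum_three_leg_le hκ x r z)

/-- [folklore] **W4, ROOT + `m ≥ 1` LEGS** (the `N`-uniform constant `Z(κ, D, m)` asked for in RULINGS-5): for a non-empty finite family of
endpoints `p i` and a root `r`,
`Σ'_u (N^D)⁻¹ e^{−κ(Σ_{i∈s}|quo N u − p i|₁ + |quo N u − r|₁)} ≤ Zl_D(κ/2) · e^{−(κ/(2·#s)) Σ_{i∈s}|p i − r|₁}` (uniform splitting; for two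
endpoints `blockSum_exp_le` keeps the sharper rate `κ/2`). -/
theorem blockSum_legs_le [NeZero N] {ι : Type*} {κ : ℝ} (hκ : 0 < κ) (s : Finset ι) (hs : s.Nonempty)
    (p : ι → Fin D → ℤ) (r : Fin D → ℤ) :
    ∑' u : Fin D → ℤ, ((N : ℝ) ^ D)⁻¹ * Real.exp (-κ * ((∑ i ∈ s, l1 (quo N u - p i)) + l1 (quo N u - r)))
      ≤ Zl D (κ / 2) * Real.exp (-(κ / (2 * s.card)) * ∑ i ∈ s, l1 (p i - r)) :=
  (tsum_blockAvg_comp_quo (N := N) (summable_legs hκ s hs p r)).trans_le (tsum_legs_le hκ s hs p r)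

/-- [folklore] … and the corresponding block-average family is summable. -/
theorem summable_blockSum_legs [NeZero N] {ι : Type*} {κ : ℝ} (hκ : 0 < κ) (s : Finset ι) (hs : s.Nonempty)
    (p : ι → Fin D → ℤ) (r : Fin D → ℤ) :
    Summable (fun u : Fin D → ℤ =>
      ((N : ℝ) ^ D)⁻¹ * Real.exp (-κ * ((∑ i ∈ s, l1 (quo N u - p i)) + l1 (quo N u - r)))) :=
  summable_blockAvg_comp_quo (N := N) (summable_legs hκ s hs p r)

/-- [folklore] The constant of a three-leg domination is nonnegative. -/
theorem nonneg_of_dominated {C e a : ℝ} (he : 0 < e) (h : |a| ≤ C * e) : 0 ≤ C :=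
  le_of_mul_le_mul_right (by simpa using (abs_nonneg a).trans h) he

/-- [folklore] DOMINATED BLOCK AVERAGE, two legs: a fine family with `|F u| ≤ C·e^{−κ(|quo N u − x|₁ + |quo N u − z|₁)}` has a summable
block average. -/
theorem summable_blockAvg_of_le₂ [NeZero N] {κ C : ℝ} (hκ : 0 < κ) {x z : Fin D → ℤ} {F : (Fin D → ℤ) → ℝ}
    (hF : ∀ u, |F u| ≤ C * Real.exp (-κ * (l1 (quo N u - x) + l1 (quo N u - z)))) :
    Summable (fun u : Fin D → ℤ => ((N : ℝ) ^ D)⁻¹ * F u) := by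
  have hmaj := (summable_blockSum_exp₂ (N := N) hκ x z).mul_left C
  refine Summable.of_norm_bounded hmaj (fun u => ?_)
  rw [Real.norm_eq_abs, abs_mul, abs_of_nonneg (by positivity)]
  calc ((N : ℝ) ^ D)⁻¹ * |F u| ≤ ((N : ℝ) ^ D)⁻¹ * (C * Real.exp (-κ * (l1 (quo N u - x) + l1 (quo N u - z)))) :=
        mul_le_mul_of_nonneg_left (hF u) (by positivity)
    _ = C * (((N : ℝ) ^ D)⁻¹ * Real.exp (-κ * (l1 (quo N u - x) + l1 (quo N u - z)))) := by ring

/-- [folklore] **DOMINATED BLOCK AVERAGE, TWO LEGS**: `|Σ'_u (N^D)⁻¹ F u| ≤ C · Zl_D(κ/2) · e^{−(κ/2)|x − z|₁}`. -/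
theorem abs_tsum_blockAvg_le₂ [NeZero N] {κ C : ℝ} (hκ : 0 < κ) {x z : Fin D → ℤ} {F : (Fin D → ℤ) → ℝ}
    (hF : ∀ u, |F u| ≤ C * Real.exp (-κ * (l1 (quo N u - x) + l1 (quo N u - z)))) :
    |∑' u : Fin D → ℤ, ((N : ℝ) ^ D)⁻¹ * F u| ≤ C * Zl D (κ / 2) * Real.exp (-(κ / 2) * l1 (x - z)) := by
  have hC : 0 ≤ C := nonneg_of_dominated (Real.exp_pos _) (hF 0)
  have hmaj := (summable_blockSum_exp₂ (N := N) hκ x z).mul_left C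
  have hpt : ∀ u : Fin D → ℤ, ‖((N : ℝ) ^ D)⁻¹ * F u‖
      ≤ C * (((N : ℝ) ^ D)⁻¹ * Real.exp (-κ * (l1 (quo N u - x) + l1 (quo N u - z)))) := by
    intro u
    rw [Real.norm_eq_abs, abs_mul, abs_of_nonneg (by positivity)]
    calc ((N : ℝ) ^ D)⁻¹ * |F u| ≤ ((N : ℝ) ^ D)⁻¹ * (C * Real.exp (-κ * (l1 (quo N u - x) + l1 (quo N u - z)))) :=
          mul_le_mul_of_nonneg_left (hF u) (by positivity)
      _ = C * (((N : ℝ) ^ D)⁻¹ * Real.exp (-κ * (l1 (quo N u - x) + l1 (quo N u - z)))) := by ring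
  have hb := tsum_of_norm_bounded hmaj.hasSum hpt
  rw [Real.norm_eq_abs] at hb
  refine hb.trans ?_
  rw [tsum_mul_left, mul_assoc]
  exact mul_le_mul_of_nonneg_left (blockSum_exp_le₂ (N := N) hκ x z) hC

/-- [folklore] DOMINATED BLOCK AVERAGE, three legs: a fine family with `|F u| ≤ C·e^{−κ(|quo N u − x|₁ + |quo N u − r|₁ + |quo N u − z|₁)}`
has a summable block average. -/
theorem summable_blockAvg_of_le₃ [NeZero N] {κ C : ℝ} (hκ : 0 < κ) {x r z : Fin D → ℤ} {F : (Fin D → ℤ) → ℝ}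
    (hF : ∀ u, |F u| ≤ C * Real.exp (-κ * (l1 (quo N u - x) + l1 (quo N u - r) + l1 (quo N u - z)))) :
    Summable (fun u : Fin D → ℤ => ((N : ℝ) ^ D)⁻¹ * F u) := by
  have hmaj := (summable_blockSum_exp (N := N) hκ x r z).mul_left C
  refine Summable.of_norm_bounded hmaj (fun u => ?_)
  rw [Real.norm_eq_abs, abs_mul, abs_of_nonneg (by positivity)]
  calc ((N : ℝ) ^ D)⁻¹ * |F u|
      ≤ ((N : ℝ) ^ D)⁻¹ * (C * Real.exp (-κ * (l1 (quo N u - x) + l1 (quo N u - r) + l1 (quo N u - z)))) :=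
        mul_le_mul_of_nonneg_left (hF u) (by positivity)
    _ = C * (((N : ℝ) ^ D)⁻¹ * Real.exp (-κ * (l1 (quo N u - x) + l1 (quo N u - r) + l1 (quo N u - z)))) := by ring

/-- [folklore] **DOMINATED BLOCK AVERAGE, THREE LEGS** (the directly consumable form of W4): if
`|F u| ≤ C·e^{−κ(|quo N u − x|₁ + |quo N u − r|₁ + |quo N u − z|₁)}` for every fine `u`, then
`|Σ'_u (N^D)⁻¹ F u| ≤ C · Zl_D(κ/2) · e^{−(κ/2)(|x − r|₁ + |z − r|₁)}` — `N`-free constant, `BiLoc`-shape in `(x, z)` at the root `r`. -/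
theorem abs_tsum_blockAvg_le₃ [NeZero N] {κ C : ℝ} (hκ : 0 < κ) {x r z : Fin D → ℤ} {F : (Fin D → ℤ) → ℝ}
    (hF : ∀ u, |F u| ≤ C * Real.exp (-κ * (l1 (quo N u - x) + l1 (quo N u - r) + l1 (quo N u - z)))) :
    |∑' u : Fin D → ℤ, ((N : ℝ) ^ D)⁻¹ * F u| ≤ C * Zl D (κ / 2) * Real.exp (-(κ / 2) * (l1 (x - r) + l1 (z - r))) := by
  have hC : 0 ≤ C := nonneg_of_dominated (Real.exp_pos _) (hF 0)
  have hmaj := (summable_blockSum_exp (N := N) hκ x r z).mul_left C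
  have hpt : ∀ u : Fin D → ℤ, ‖((N : ℝ) ^ D)⁻¹ * F u‖
      ≤ C * (((N : ℝ) ^ D)⁻¹ * Real.exp (-κ * (l1 (quo N u - x) + l1 (quo N u - r) + l1 (quo N u - z)))) := by
    intro u
    rw [Real.norm_eq_abs, abs_mul, abs_of_nonneg (by positivity)]
    calc ((N : ℝ) ^ D)⁻¹ * |F u|
        ≤ ((N : ℝ) ^ D)⁻¹ * (C * Real.exp (-κ * (l1 (quo N u - x) + l1 (quo N u - r) + l1 (quo N u - z)))) :=
          mul_le_mul_of_nonneg_left (hF u) (by positivity)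
      _ = C * (((N : ℝ) ^ D)⁻¹ * Real.exp (-κ * (l1 (quo N u - x) + l1 (quo N u - r) + l1 (quo N u - z)))) := by ring
  have hb := tsum_of_norm_bounded hmaj.hasSum hpt
  rw [Real.norm_eq_abs] at hb
  refine hb.trans ?_
  rw [tsum_mul_left, mul_assoc]
  exact mul_le_mul_of_nonneg_left (blockSum_exp_le (N := N) hκ x r z) hC

end Summit.QuantumFields.BalabanUV.Beta.GAN24.TaylorBlockSum
end
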